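import Literature.NumberTheory.Sieve.GoldstonPintzYildirimThetaPerron
import Literature.NumberTheory.Sieve.GoldstonPintzYildirimThetaIntegrand
import Literature.NumberTheory.Sieve.GoldstonPintzYildirimLemma3Setup
import HarnessLib

/-!
# Goldston–Pintz–Yıldırım, *Primes in tuples I*, §9: `𝒯̃_R = 𝒯*_R(a,b,d,u,v)` with `G = GStar`

Trunk: NumberTheory / Sieve. GPY, *Primes in tuples. I* (Ann. of Math. 170 (2009) =
arXiv:math/0508185), §9, last paragraph (p. 20): "by (9.15), (9.17), and (7.15), all four terms
are of the form `𝒯*_R` [(8.1)] … with the notational changes `W` and `G = G_{ℓ₁,ℓ₂}`… In Case 1 we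
have `a = k₁, b = k₂, d = r, u = ℓ₁, v = ℓ₂`, [in Case 2 `a = k₁ − 1, u = ℓ₁ + 1`, …]." This file
PROVES that identification against the tree's `lemma3T` of `GoldstonPintzYildirimLemma3Setup`
(theorems only):

* `lemma3F_GStar_eq` — on `Re s₁ = Re s₂ = 1` the integrand (8.1) built from
  `G = GStar h₀ H₁ H₂ a b d` is `F(s₁,s₂) R^{s₁}s₁^{−(u+a+1)} R^{s₂}s₂^{−(v+b+1)}` (`F = FDir₂Star`);
* `mainTRTheta_eq_lemma3T` — both `Hᵢ` nonempty, `a ≤ K₁ = k₁+ℓ₁`, `b ≤ K₂ = k₂+ℓ₂`: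
  `𝒯̃_R(H₁,H₂,ℓ₁,ℓ₂,h₀) = 𝒯*_R(a, b, d, K₁ − a, K₂ − b)` with `G = GStar h₀ H₁ H₂ a b d`
  (any `d`; for Proposition 2, `(a,b,d)` are the case exponents);
* `mainTRTheta_empty_mul_log_eq_lemma3T` — `H₂ = ∅`: `𝒯̃_R(H₁,∅,ℓ₁,0,h₀) · log R = 𝒯*_R(a, 0, 0, K₁ − a, 1)`
  with `G = GStar h₀ H₁ ∅ a 0 0` (dummy second variable, `v = 1`).

## References

* D. A. Goldston, J. Pintz, C. Y. Yıldırım, *Primes in tuples. I*, Ann. of Math. (2) 170 (2009),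
  819–862 = arXiv:math/0508185, §8 (8.1)–(8.2), §9 (9.15)–(9.19) and last paragraph.
  [cite: GoldstonPintzYildirim2009]
-/

noncomputable section

open Finset MeasureTheory Complex Literature.Analysis.Complex
open Literature.NumberTheory.LFunctions.Nicolas (zetaOne)

namespace Literature.NumberTheory.Sieve.GPY

/-- On `Re s₁ = Re s₂ = 1`: the integrand (8.1) with `G = GStar h₀ H₁ H₂ a b d` equals
`F(s₁,s₂) · R^{s₁}s₁^{−(u+a+1)} · R^{s₂}s₂^{−(v+b+1)}`.
[cite: GoldstonPintzYildirim2009, Section 8 eq. 8.1] -/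
theorem lemma3F_GStar_eq {R : ℝ} (hR : 0 < R) (h₀ : ℕ) {H₁ H₂ : Finset ℕ} (hk : 1 ≤ #H₁ + #H₂)
    (a b d u v : ℕ) (t₁ t₂ : ℝ) :
    lemma3F (fun s₁ s₂ => GStar h₀ H₁ H₂ a b d s₁ s₂) R a b d u v (((1 : ℝ) : ℂ) + t₁ * I)
        (((1 : ℝ) : ℂ) + t₂ * I) =
      FDir₂Star h₀ H₁ H₂ (((1 : ℝ) : ℂ) + t₁ * I) (((1 : ℝ) : ℂ) + t₂ * I) *
        perronPow R (u + a) (((1 : ℝ) : ℂ) + t₁ * I) * perronPow R (v + b) (((1 : ℝ) : ℂ) + t₂ * I) := by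
  rw [FDir₂Star_mul_perronPow_eq_lemma3Form hR h₀ hk a b d u v t₁ t₂, lemma3F, lemma3D]
  simp only [Literature.NumberTheory.LFunctions.Nicolas.zetaOne_eq_riemannZeta₁]
  rw [show (1 : ℂ) + ((((1 : ℝ) : ℂ) + t₁ * I) + (((1 : ℝ) : ℂ) + t₂ * I)) =
      1 + (((1 : ℝ) : ℂ) + t₁ * I) + (((1 : ℝ) : ℂ) + t₂ * I) by ring]
  ring

/-- **`𝒯̃_R = 𝒯*_R(a, b, d, K₁ − a, K₂ − b)`** for both `Hᵢ` nonempty, `a ≤ K₁ = k₁ + ℓ₁`,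
`b ≤ K₂ = k₂ + ℓ₂`, `R > 0`, with `G = GStar h₀ H₁ H₂ a b d` ((9.15) + (9.17) + (7.15)).
[cite: GoldstonPintzYildirim2009, Section 9 eq. 9.15] -/
theorem mainTRTheta_eq_lemma3T {R : ℝ} (hR : 0 < R) (h₀ : ℕ) {H₁ H₂ : Finset ℕ} (h₁ : H₁.Nonempty)
    (h₂ : H₂.Nonempty) (ℓ₁ ℓ₂ : ℕ) {a b : ℕ} (d : ℕ) (ha : a ≤ #H₁ + ℓ₁) (hb : b ≤ #H₂ + ℓ₂) :
    (mainTRTheta R H₁ H₂ ℓ₁ ℓ₂ h₀ : ℂ) =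
      lemma3T (fun s₁ s₂ => GStar h₀ H₁ H₂ a b d s₁ s₂) R a b d (#H₁ + ℓ₁ - a) (#H₂ + ℓ₂ - b) := by
  have hk : 1 ≤ #H₁ + #H₂ := le_add_right h₁.card_pos
  rw [lemma3T]
  have hint : (fun t₂ : ℝ => ∫ t₁ : ℝ, lemma3F (fun s₁ s₂ => GStar h₀ H₁ H₂ a b d s₁ s₂) R a b d
      (#H₁ + ℓ₁ - a) (#H₂ + ℓ₂ - b) (((1 : ℝ) : ℂ) + t₁ * I) (((1 : ℝ) : ℂ) + t₂ * I)) =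
      fun t₂ : ℝ => ∫ t₁ : ℝ, FDir₂Star h₀ H₁ H₂ (((1 : ℝ) : ℂ) + t₁ * I) (((1 : ℝ) : ℂ) + t₂ * I) *
        perronPow R (#H₁ + ℓ₁) (((1 : ℝ) : ℂ) + t₁ * I) *
          perronPow R (#H₂ + ℓ₂) (((1 : ℝ) : ℂ) + t₂ * I) := by
    funext t₂
    refine integral_congr_ae (Filter.Eventually.of_forall fun t₁ => ?_)
    beta_reduce
    rw [lemma3F_GStar_eq hR h₀ hk, Nat.sub_add_cancel ha, Nat.sub_add_cancel hb]
  rw [hint, integral_integral_FDir₂Star_mul_perronPow hR h₀ h₁ h₂ ℓ₁ ℓ₂]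
  have hπ : ((2 * Real.pi) ^ 2 : ℂ) ≠ 0 := by
    exact_mod_cast (pow_pos (mul_pos two_pos Real.pi_pos) 2).ne'
  field_simp

/-- **`𝒯̃_R(H₁, ∅, ℓ₁, 0, h₀) · log R = 𝒯*_R(a, 0, 0, K₁ − a, 1)`** for `H₁` nonempty, `a ≤ K₁`,
`R > 0`, with `G = GStar h₀ H₁ ∅ a 0 0` (the dummy second variable with `v = 1`).
[cite: GoldstonPintzYildirim2009, Section 9 eq. 9.15] -/
theorem mainTRTheta_empty_mul_log_eq_lemma3T {R : ℝ} (hR : 0 < R) (h₀ : ℕ) {H₁ : Finset ℕ}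
    (h₁ : H₁.Nonempty) (ℓ₁ : ℕ) {a : ℕ} (ha : a ≤ #H₁ + ℓ₁) :
    (mainTRTheta R H₁ ∅ ℓ₁ 0 h₀ : ℂ) * (Real.log R : ℂ) =
      lemma3T (fun s₁ s₂ => GStar h₀ H₁ ∅ a 0 0 s₁ s₂) R a 0 0 (#H₁ + ℓ₁ - a) 1 := by
  have hk : 1 ≤ #H₁ + #(∅ : Finset ℕ) := by simpa using h₁.card_pos
  rw [lemma3T]
  have hint : (fun t₂ : ℝ => ∫ t₁ : ℝ, lemma3F (fun s₁ s₂ => GStar h₀ H₁ ∅ a 0 0 s₁ s₂) R a 0 0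
      (#H₁ + ℓ₁ - a) 1 (((1 : ℝ) : ℂ) + t₁ * I) (((1 : ℝ) : ℂ) + t₂ * I)) =
      fun t₂ : ℝ => ∫ t₁ : ℝ, FDir₂Star h₀ H₁ ∅ (((1 : ℝ) : ℂ) + t₁ * I) (((1 : ℝ) : ℂ) + t₂ * I) *
        perronPow R (#H₁ + ℓ₁) (((1 : ℝ) : ℂ) + t₁ * I) *
          perronPow R 1 (((1 : ℝ) : ℂ) + t₂ * I) := by
    funext t₂
    refine integral_congr_ae (Filter.Eventually.of_forall fun t₁ => ?_)
    beta_reduce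
    rw [lemma3F_GStar_eq hR h₀ hk, Nat.sub_add_cancel ha]
  rw [hint, integral_integral_FDir₂Star_mul_perronPow_empty hR h₀ h₁ ℓ₁]
  have hπ : ((2 * Real.pi) ^ 2 : ℂ) ≠ 0 := by
    exact_mod_cast (pow_pos (mul_pos two_pos Real.pi_pos) 2).ne'
  field_simp

end Literature.NumberTheory.Sieve.GPY
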